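import Summits.CriticalPhenomena.PercolationContinuityZ3.Theorems.Transplant.SkelSignStepI
import HarnessLib

/-!
# D″ node v2.1 (DPRIME-SCOPE addendum N, "typed route centres"): STEP I′ WITH AN ACTIVE-TYPE SET AND A REQUESTED SEED OFFSET —
# `Skelφ.exists_stepIGen (T ⊆ types) (off₀ m₀)`, and the SINGLE-TYPE form `exists_stepI_single (t₀ ∈ types)` exposing the TWO-UNIT PROPERTY
# `StepI.TwoUnit D` of the data's band (from `TwoAxis.exists_twoUnit`, which needs ONE monotone band — the envelope over several frame types of
# `exists_stepI` (p248853) is not one); `PlanarSkeletonSign` instances of both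

builds on p205010 (kernel theorem, internal audit signed; external expert review pending) — nothing in this file uses p205010.
Lane `prim-bschramm`, seat `prim-bschramm-p3` (gen 7; D″ design owner); helper file (`--supports stmt-CriticalPhenomena-4575`).
WHY (v2.1): the route rectangles of the chains are sized by a band `(Gb, Fb)` that must satisfy the two-unit inequalities
`c·Gb(3eₓ) ≤ A·e_y ∧ c·Fb(3e_y) ≤ A·eₓ`; these hold for a single monotone band, not for the sup over types.  v2.1 launches every route from a
vertex in the orbit of ONE base vertex `t₀` (the root's type) — data `D_r` from `exists_stepI_single` — and keeps the all-types data `D_k` of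
`exists_stepIGen (T := types)` for the kits and zones; `off₀`/`m₀` let the kit call dominate the route call (seed nesting, `SkelPhiTypedCtr`).
* §1 `StepI.TwoUnit D` (the two-unit property of `(D.Gb, D.Fb)` above the seed scale `D.k`);
* §2 **`exists_stepIGen`** (bands = envelopes over `T`, inputs for `index T Sz Sx Sy`, `off₀ ≤ off`, `m₀ ≤ D.k`, `7 ≤ D.k`);
* §3 **`exists_stepI_single`** (`T = {t₀}`: the same plus `StepI.TwoUnit D`);
* §4 `PlanarSkeletonSign.exists_stepIGen / exists_stepI_single` (dictionary hypotheses discharged as in `SkelSignStepI`).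
[cite: KozmaNitzan2024, §4 p. 17 (Step I), Lemma 7 (p. 15), Lemma 9 (p. 16)] [cite: GrimmettPercolation1999, §7.3 (7.41)–(7.52)]
-/

noncomputable section

open MeasureTheory

namespace Summit.CriticalPhenomena.PercolationContinuityZ3.Theorems.Transplant

namespace Skelφ

open Literature.Probability.Percolation Literature.Probability.LatticeModels SimpleGraph KNLevels
open Literature.Barriers.CriticalPhenomena (graphBall graphBall_finite mem_graphBall_self graphBall_mono HasExponentialGrowth)
open scoped Classical

variable {V : Type} {G : SimpleGraph V} [G.LocallyFinite] {φ : V → Site 2} {types : Finset V}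

/-! ## §1 The two-unit property of the data's band -/

/-- **The two-unit property of Step-I′ data**: for every `c ≥ 1`, `A ≥ 6c` and floor `n₀` there are step extents `eₓ, e_y ≥ max n₀ D.k` with
`c·Gb(3eₓ) ≤ A·e_y` and `c·Fb(3e_y) ≤ A·eₓ` (the conclusion of `TwoAxis.exists_twoUnit` for the band `(D.Gb, D.Fb)`).
[cite: KozmaNitzan2024, §4 Lemma 11 (pp. 22–23), Theorem 6 Step III (p. 30)] -/
def StepI.TwoUnit (D : StepI.Data V) : Prop :=
  ∀ (c A n₀ : ℕ), 1 ≤ c → 6 * c ≤ A →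
    ∃ ex ey : ℕ, n₀ ≤ ex ∧ n₀ ≤ ey ∧ D.k ≤ ex ∧ D.k ≤ ey ∧ c * D.Gb (3 * ex) ≤ A * ey ∧ c * D.Fb (3 * ey) ≤ A * ex

/-! ## §2 Step I′ with an active-type set and a requested offset -/

section Assembly

variable [Countable V] (hfr : Frames G φ types) {p : unitInterval} (hC : CylSubcritical G φ types p)

/-- **The core construction** (internal form exposing the per-type bands): seed scale `m ≥ max m₀ 7`, offset `off = max off₀ (cylRadMax m m)`,
bands = envelopes over the active types `T ⊆ types`, zones at every `t ∈ T`, thresholds `M₀ n₁`, and every input over `index T Sz Sx Sy` of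
probability `> 1 − δ` at `p`. [cite: KozmaNitzan2024, §4 p. 17 (Step I)] -/
theorem exists_stepI_core [DecidableEq V] (hlip : Lip G φ) (hstep : Steps G φ) (hκ : CylConn G φ types) (hp0 : 0 < (p : ℝ))
    (hsl : SlabInputs G φ types p) {z : V} (hθ : 0 < theta G z p) (hU : ∀ᵐ ω ∂(bondPercolation G p), numInfiniteClusters ω ≤ 1)
    {T : Finset V} (hT : T ⊆ types) (hneg : ∀ t ∈ T, NegAt G φ t) (hflip : ∀ t ∈ T, FlipAt G φ t) {δ : ℝ} (hδ : 0 < δ) (m₀ off₀ : ℕ) :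
    ∃ (D : StepI.Data V) (off M₀ n₁ : ℕ) (η : ℝ), m₀ ≤ D.k ∧ 7 ≤ D.k ∧ D.R = fatRadius hfr hC ∧ D.Λ = fatSeqOff hfr hC off ∧ D.k < M₀ ∧
      D.k < n₁ ∧ (∀ ℓ, D.k ≤ D.Gb ℓ ∧ D.k ≤ D.Fb ℓ) ∧ off₀ ≤ off ∧
      (∀ t ∈ T, TwoAxis.IsMonotoneBand
        (fun ℓ₁ ℓ₂ => (bondPercolation G p).real (TwoAxis.TopsHit (relCoord φ t 0) (relCoord φ t 1) ↑(fatSeqOff hfr hC off t D.k) ℓ₁ ℓ₂))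
        (fun ℓ₁ ℓ₂ => (bondPercolation G p).real (TwoAxis.SidesHit (relCoord φ t 0) (relCoord φ t 1) ↑(fatSeqOff hfr hC off t D.k) ℓ₁ ℓ₂))
        (1 - Real.sqrt η) D.k) ∧
      (∀ ℓ, D.Gb ℓ = max D.k (T.sup fun t => TwoAxis.bandG
        (fun ℓ₁ ℓ₂ => (bondPercolation G p).real (TwoAxis.SidesHit (relCoord φ t 0) (relCoord φ t 1) ↑(fatSeqOff hfr hC off t D.k) ℓ₁ ℓ₂))
        (1 - Real.sqrt η) D.k ℓ)) ∧
      (∀ ℓ, D.Fb ℓ = max D.k (T.sup fun t => TwoAxis.bandFinv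
        (fun ℓ₁ ℓ₂ => (bondPercolation G p).real (TwoAxis.TopsHit (relCoord φ t 0) (relCoord φ t 1) ↑(fatSeqOff hfr hC off t D.k) ℓ₁ ℓ₂))
        (1 - Real.sqrt η) D.k ℓ)) ∧
      ∀ Sz Sx Sy : Finset ℕ, (∀ M ∈ Sz, M₀ ≤ M) → (∀ ℓ ∈ Sx, n₁ ≤ ℓ) → (∀ ℓ ∈ Sy, n₁ ≤ ℓ) →
        ∀ i ∈ StepI.index T Sz Sx Sy, 1 - δ < (bondPercolation G p).real (StepI.event G φ D i) := by
  set μ := bondPercolation G p with hμ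
  -- the tolerances
  set δ' : ℝ := min δ 1 with hδ'
  have hδ'0 : 0 < δ' := lt_min hδ one_pos
  have hδ'δ : δ' ≤ δ := min_le_left _ _
  have hδ'1 : δ' ≤ 1 := min_le_right _ _
  set x : ℝ := δ' / 2 with hx
  have hx0 : 0 < x := by positivity
  set η : ℝ := ((x ^ 2) ^ 2) ^ 2 with hη
  have hη0 : 0 < η := by positivity
  have hx1 : x ≤ 1 := by rw [hx]; linarith
  have hη1 : η ≤ 1 := by
    have h2 : x ^ 2 ≤ 1 := pow_le_one₀ hx0.le hx1
    have h4 : (x ^ 2) ^ 2 ≤ 1 := pow_le_one₀ (by positivity) h2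
    exact pow_le_one₀ (by positivity) h4
  have h8 : Real.sqrt (Real.sqrt (Real.sqrt η)) = x := sqrt_sqrt_sqrt_pow8 hx0.le
  obtain ⟨N, hN⟩ := exists_pow_lt_of_lt_one hx0 (show (1 / 2 : ℝ) < 1 by norm_num)
  -- the seed scale, uniform over the base vertices and the shifts
  obtain ⟨m, hm₀, hseed⟩ := exists_seed_scale hfr hC hκ hθ hη0 (max m₀ 7)
  have hm0 : m₀ ≤ m := le_trans (le_max_left _ _) hm₀
  have hm7 : 7 ≤ m := le_trans (le_max_right _ _) hm₀
  have hm1 : 1 ≤ m := le_trans (by norm_num) hm7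
  -- the radius shift (at least the requested one)
  set off : ℕ := max off₀ (cylRadMax G φ types m m) with hoff
  have hoff' : ∀ t ∈ types, cylRad G φ t m m ≤ fatRadius hfr hC m + off := fun t ht =>
    ((cylRad_le_cylRadMax G φ ht m m).trans (le_max_right _ _)).trans (Nat.le_add_left _ _)
  -- the per-type bands (active types) and the envelopes over `T`
  have hb : ∀ t ∈ T, TwoAxis.IsMonotoneBand
      (fun ℓ₁ ℓ₂ => μ.real (TwoAxis.TopsHit (relCoord φ t 0) (relCoord φ t 1) ↑(fatSeqOff hfr hC off t m) ℓ₁ ℓ₂))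
      (fun ℓ₁ ℓ₂ => μ.real (TwoAxis.SidesHit (relCoord φ t 0) (relCoord φ t 1) ↑(fatSeqOff hfr hC off t m) ℓ₁ ℓ₂)) (1 - Real.sqrt η) m :=
    fun t ht => isMonotoneBand_at hlip hstep hκ hfr hp0 hC hsl (hT ht) hm1 (hoff' t (hT ht)) hη1 (hseed t (hT ht) off)
  set Gb : ℕ → ℕ := fun ℓ => max m (T.sup fun t => TwoAxis.bandG
    (fun ℓ₁ ℓ₂ => μ.real (TwoAxis.SidesHit (relCoord φ t 0) (relCoord φ t 1) ↑(fatSeqOff hfr hC off t m) ℓ₁ ℓ₂)) (1 - Real.sqrt η) m ℓ) with hGb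
  set Fb : ℕ → ℕ := fun ℓ => max m (T.sup fun t => TwoAxis.bandFinv
    (fun ℓ₁ ℓ₂ => μ.real (TwoAxis.TopsHit (relCoord φ t 0) (relCoord φ t 1) ↑(fatSeqOff hfr hC off t m) ℓ₁ ℓ₂)) (1 - Real.sqrt η) m ℓ) with hFb
  have hGb' : ∀ t ∈ T, ∀ ℓ, TwoAxis.bandG
      (fun ℓ₁ ℓ₂ => μ.real (TwoAxis.SidesHit (relCoord φ t 0) (relCoord φ t 1) ↑(fatSeqOff hfr hC off t m) ℓ₁ ℓ₂)) (1 - Real.sqrt η) m ℓ ≤ Gb ℓ :=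
    fun t ht ℓ => le_max_of_le_right (Finset.le_sup (f := fun t => TwoAxis.bandG
      (fun ℓ₁ ℓ₂ => μ.real (TwoAxis.SidesHit (relCoord φ t 0) (relCoord φ t 1) ↑(fatSeqOff hfr hC off t m) ℓ₁ ℓ₂)) (1 - Real.sqrt η) m ℓ) ht)
  have hFb' : ∀ t ∈ T, ∀ ℓ, TwoAxis.bandFinv
      (fun ℓ₁ ℓ₂ => μ.real (TwoAxis.TopsHit (relCoord φ t 0) (relCoord φ t 1) ↑(fatSeqOff hfr hC off t m) ℓ₁ ℓ₂)) (1 - Real.sqrt η) m ℓ ≤ Fb ℓ :=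
    fun t ht ℓ => le_max_of_le_right (Finset.le_sup (f := fun t => TwoAxis.bandFinv
      (fun ℓ₁ ℓ₂ => μ.real (TwoAxis.TopsHit (relCoord φ t 0) (relCoord φ t 1) ↑(fatSeqOff hfr hC off t m) ℓ₁ ℓ₂)) (1 - Real.sqrt η) m ℓ) ht)
  -- the uniqueness zone of the shifted fat prisms at every active base vertex
  have hzone : ∀ t ∈ T, ∃ n₀ : ℕ, ∀ n, n₀ ≤ n → 1 - δ' < μ.real (UniqZone.zone G (fatSeqOff hfr hC off t) m n) :=
    fun t ht => UniqZone.exists_forall_le_lt_real_zone p hU (fatSeqOff_nest hfr hC off hlip t)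
      (fatSeqOff_monotone hfr hC off t) (fatSeqOff_exhaust hfr hC off hκ (hT ht)) m hδ'0
  choose! n₀ hn₀ using hzone
  -- the thresholds and the data
  set M₀ : ℕ := T.sup n₀ + m + 1 with hM₀
  set n₁ : ℕ := fatRadius hfr hC m + off + N + 1 with hn₁
  have hkM : m < M₀ := by rw [hM₀]; omega
  have hkn : m < n₁ := by rw [hn₁]; have := le_fatRadius hfr hC m; omega
  refine ⟨⟨fatSeqOff hfr hC off, m, fatRadius hfr hC, Gb, Fb⟩, off, M₀, n₁, η, hm0, hm7, rfl, rfl, hkM, hkn,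
    fun ℓ => ⟨le_max_left _ _, le_max_left _ _⟩, le_max_left _ _, hb, fun ℓ => rfl, fun ℓ => rfl, ?_⟩
  intro Sz Sx Sy hSz hSx hSy i hi
  obtain ⟨t, s, og⟩ := i
  obtain ⟨ht, hz, h0, h1⟩ := StepI.of_mem_index hi
  -- the common bound for a link input at an extent `ℓ ≥ n₁`
  have htail : ∀ ℓ, n₁ ≤ ℓ → (1 / 2 : ℝ) ^ ℓ < x := fun ℓ hℓ =>
    lt_of_le_of_lt (pow_le_pow_of_le_one (by norm_num) (by norm_num) (by omega)) hN
  rcases og with _ | ⟨ax, σ, τ⟩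
  · -- the zone
    have hs := hSz s (hz rfl)
    have h := hn₀ t ht s (by have := Finset.le_sup (f := n₀) ht; omega)
    rw [StepI.event_none]
    exact lt_of_le_of_lt (by linarith) h
  · rw [StepI.event_some]
    fin_cases ax
    · -- x-links
      have hs := hSx s (h0 σ τ rfl)
      have hb0 := real_event_zero_ge hfr hC (hT ht) (hb t ht) (hneg t ht) (hflip t ht) Gb Fb (hGb' t ht s) (by omega) σ τ
      rw [h8] at hb0
      have := htail s hs
      exact lt_of_lt_of_le (by linarith) hb0
    · -- y-links
      have hs := hSy s (h1 σ τ rfl)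
      have hb1 := real_event_one_ge hfr hC (hT ht) (hb t ht) (hneg t ht) (hflip t ht) Gb Fb (hFb' t ht s) (by omega) σ τ
      rw [h8] at hb1
      have := htail s hs
      exact lt_of_lt_of_le (by linarith) hb1

/-- **STEP I′ WITH AN ACTIVE-TYPE SET `T ⊆ types` AND A REQUESTED OFFSET `off₀`** (v2.1): as `exists_stepI` (p248853) but the bands are the
envelopes over `T` only, the inputs are certified over `StepI.index T Sz Sx Sy`, the seed offset satisfies `off₀ ≤ off` and the seed scale
`D.k ≥ max m₀ 7`.  (`T := types` is the KIT data `D_k`; `T := {t₀}` the ROUTE data, below.) [cite: KozmaNitzan2024, §4 p. 17 (Step I)] -/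
theorem exists_stepIGen [DecidableEq V] (hlip : Lip G φ) (hstep : Steps G φ) (hκ : CylConn G φ types) (hp0 : 0 < (p : ℝ))
    (hsl : SlabInputs G φ types p) {z : V} (hθ : 0 < theta G z p) (hU : ∀ᵐ ω ∂(bondPercolation G p), numInfiniteClusters ω ≤ 1)
    {T : Finset V} (hT : T ⊆ types) (hneg : ∀ t ∈ T, NegAt G φ t) (hflip : ∀ t ∈ T, FlipAt G φ t) {δ : ℝ} (hδ : 0 < δ) (m₀ off₀ : ℕ) :
    ∃ (D : StepI.Data V) (off M₀ n₁ : ℕ), m₀ ≤ D.k ∧ 7 ≤ D.k ∧ D.R = fatRadius hfr hC ∧ D.Λ = fatSeqOff hfr hC off ∧ D.k < M₀ ∧ D.k < n₁ ∧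
      (∀ ℓ, D.k ≤ D.Gb ℓ ∧ D.k ≤ D.Fb ℓ) ∧ off₀ ≤ off ∧
      ∀ Sz Sx Sy : Finset ℕ, (∀ M ∈ Sz, M₀ ≤ M) → (∀ ℓ ∈ Sx, n₁ ≤ ℓ) → (∀ ℓ ∈ Sy, n₁ ≤ ℓ) →
        ∀ i ∈ StepI.index T Sz Sx Sy, 1 - δ < (bondPercolation G p).real (StepI.event G φ D i) := by
  obtain ⟨D, off, M₀, n₁, η, h0, h7, hR, hΛ, hM, hn, hGF, hoff, -, -, -, hfam⟩ :=
    exists_stepI_core hfr hC hlip hstep hκ hp0 hsl hθ hU hT hneg hflip hδ m₀ off₀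
  exact ⟨D, off, M₀, n₁, h0, h7, hR, hΛ, hM, hn, hGF, hoff, hfam⟩

/-! ## §3 The single-type form with the two-unit property -/

/-- **STEP I′ FOR ONE BASE VERTEX `t₀`** (v2.1 ROUTE data): as `exists_stepIGen (T := {t₀})`, and the data's band — now a single monotone band —
has the two-unit property `StepI.TwoUnit D` (`TwoAxis.exists_twoUnit`). [cite: KozmaNitzan2024, §4 p. 17 (Step I), Lemma 11 (pp. 22–23)] -/
theorem exists_stepI_single [DecidableEq V] (hlip : Lip G φ) (hstep : Steps G φ) (hκ : CylConn G φ types) (hp0 : 0 < (p : ℝ))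
    (hsl : SlabInputs G φ types p) {z : V} (hθ : 0 < theta G z p) (hU : ∀ᵐ ω ∂(bondPercolation G p), numInfiniteClusters ω ≤ 1)
    {t₀ : V} (ht₀ : t₀ ∈ types) (hneg : NegAt G φ t₀) (hflip : FlipAt G φ t₀) {δ : ℝ} (hδ : 0 < δ) (m₀ off₀ : ℕ) :
    ∃ (D : StepI.Data V) (off M₀ n₁ : ℕ), m₀ ≤ D.k ∧ 7 ≤ D.k ∧ D.R = fatRadius hfr hC ∧ D.Λ = fatSeqOff hfr hC off ∧ D.k < M₀ ∧ D.k < n₁ ∧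
      (∀ ℓ, D.k ≤ D.Gb ℓ ∧ D.k ≤ D.Fb ℓ) ∧ off₀ ≤ off ∧ StepI.TwoUnit D ∧
      ∀ Sz Sx Sy : Finset ℕ, (∀ M ∈ Sz, M₀ ≤ M) → (∀ ℓ ∈ Sx, n₁ ≤ ℓ) → (∀ ℓ ∈ Sy, n₁ ≤ ℓ) →
        ∀ i ∈ StepI.index {t₀} Sz Sx Sy, 1 - δ < (bondPercolation G p).real (StepI.event G φ D i) := by
  have hT : ({t₀} : Finset V) ⊆ types := Finset.singleton_subset_iff.2 ht₀
  obtain ⟨D, off, M₀, n₁, η, h0, h7, hR, hΛ, hM, hn, hGF, hoff, hb, hGb, hFb, hfam⟩ :=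
    exists_stepI_core hfr hC hlip hstep hκ hp0 hsl hθ hU hT (fun t ht => by rw [Finset.mem_singleton.1 ht]; exact hneg)
      (fun t ht => by rw [Finset.mem_singleton.1 ht]; exact hflip) hδ m₀ off₀
  refine ⟨D, off, M₀, n₁, h0, h7, hR, hΛ, hM, hn, hGF, hoff, ?_, hfam⟩
  -- the two-unit property of the single band
  intro c A n₀ hc hA
  have hb₀ := hb t₀ (Finset.mem_singleton_self t₀)
  obtain ⟨ex, ey, hex, hey, hmx, hmy, hG, hF⟩ := TwoAxis.exists_twoUnit hb₀ h7 hc hA n₀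
  refine ⟨ex, ey, hex, hey, hmx, hmy, ?_, ?_⟩
  · rw [hGb (3 * ex), Finset.sup_singleton,
      max_eq_right (TwoAxis.bandG_spec hb₀ (show D.k ≤ 3 * ex by omega)).1]
    exact hG
  · rw [hFb (3 * ey), Finset.sup_singleton,
      max_eq_right (TwoAxis.bandFinv_spec hb₀ (show D.k ≤ 3 * ey by omega)).1]
    exact hF

end Assembly

end Skelφ

/-! ## §4 The `PlanarSkeletonSign` instances -/

namespace PlanarSkeletonSign

open Literature.Probability.Percolation Literature.Probability.LatticeModels SimpleGraph
open Literature.Barriers.CriticalPhenomena (HasExponentialGrowth)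
open scoped Classical

variable {V : Type} [DecidableEq V] [Countable V] {G : SimpleGraph V} [G.LocallyFinite] (Φ : PlanarSkeletonSign G)

/-- **Step I′ with an active-type set on a `PlanarSkeletonSign` graph** of subexponential growth (v2.1 KIT data at `T := Φ.types`).
[cite: KozmaNitzan2024, §4 p. 17 (Step I)] -/
theorem exists_stepIGen (hG : ¬ HasExponentialGrowth G) {p : unitInterval} (hC : Φ.CylSubcritical p) {z : V} (hθ : 0 < theta G z p)
    {T : Finset V} (hT : T ⊆ Φ.types) (hT₀ : T.Nonempty) {δ : ℝ} (hδ : 0 < δ) (m₀ off₀ : ℕ) :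
    ∃ (D : Skelφ.StepI.Data V) (off M₀ n₁ : ℕ), m₀ ≤ D.k ∧ 7 ≤ D.k ∧ D.R = Skelφ.fatRadius Φ.frame hC ∧
      D.Λ = Skelφ.fatSeqOff Φ.frame hC off ∧ D.k < M₀ ∧ D.k < n₁ ∧ (∀ ℓ, D.k ≤ D.Gb ℓ ∧ D.k ≤ D.Fb ℓ) ∧ off₀ ≤ off ∧
      ∀ Sz Sx Sy : Finset ℕ, (∀ M ∈ Sz, M₀ ≤ M) → (∀ ℓ ∈ Sx, n₁ ≤ ℓ) → (∀ ℓ ∈ Sy, n₁ ≤ ℓ) →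
        ∀ i ∈ Skelφ.StepI.index T Sz Sx Sy, 1 - δ < (bondPercolation G p).real (Skelφ.StepI.event G Φ.φ D i) := by
  obtain ⟨t₁, ht₁⟩ := hT₀
  exact Skelφ.exists_stepIGen (hfr := Φ.frame) (hC := hC) Φ.lip Φ.step Φ.cyl_connected (pos_of_theta_pos hθ) (Φ.slabInputs hG p) hθ
    (Φ.numInfiniteClusters_le_one hG (hT ht₁) p) hT (fun _ ht => Φ.negAt (hT ht)) (fun _ ht => Φ.flipAt (hT ht)) hδ m₀ off₀

/-- **Step I′ for one base vertex on a `PlanarSkeletonSign` graph** of subexponential growth, with the two-unit property (v2.1 ROUTE data).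
[cite: KozmaNitzan2024, §4 p. 17 (Step I), Lemma 11 (pp. 22–23)] -/
theorem exists_stepI_single (hG : ¬ HasExponentialGrowth G) {p : unitInterval} (hC : Φ.CylSubcritical p) {z : V} (hθ : 0 < theta G z p)
    {t₀ : V} (ht₀ : t₀ ∈ Φ.types) {δ : ℝ} (hδ : 0 < δ) (m₀ off₀ : ℕ) :
    ∃ (D : Skelφ.StepI.Data V) (off M₀ n₁ : ℕ), m₀ ≤ D.k ∧ 7 ≤ D.k ∧ D.R = Skelφ.fatRadius Φ.frame hC ∧
      D.Λ = Skelφ.fatSeqOff Φ.frame hC off ∧ D.k < M₀ ∧ D.k < n₁ ∧ (∀ ℓ, D.k ≤ D.Gb ℓ ∧ D.k ≤ D.Fb ℓ) ∧ off₀ ≤ off ∧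
      Skelφ.StepI.TwoUnit D ∧
      ∀ Sz Sx Sy : Finset ℕ, (∀ M ∈ Sz, M₀ ≤ M) → (∀ ℓ ∈ Sx, n₁ ≤ ℓ) → (∀ ℓ ∈ Sy, n₁ ≤ ℓ) →
        ∀ i ∈ Skelφ.StepI.index {t₀} Sz Sx Sy, 1 - δ < (bondPercolation G p).real (Skelφ.StepI.event G Φ.φ D i) :=
  Skelφ.exists_stepI_single (hfr := Φ.frame) (hC := hC) Φ.lip Φ.step Φ.cyl_connected (pos_of_theta_pos hθ) (Φ.slabInputs hG p) hθ
    (Φ.numInfiniteClusters_le_one hG ht₀ p) ht₀ (Φ.negAt ht₀) (Φ.flipAt ht₀) hδ m₀ off₀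

end PlanarSkeletonSign

end Summit.CriticalPhenomena.PercolationContinuityZ3.Theorems.Transplant

end
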